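import Mathlib.RingTheory.AdicCompletion.LocalRing
import Mathlib.RingTheory.AdicCompletion.AsTensorProduct
import Mathlib.RingTheory.AdicCompletion.Noetherian
import Mathlib.RingTheory.Flat.FaithfullyFlat.Algebra
import Mathlib.RingTheory.RegularLocalRing.Defs
import Mathlib.Algebra.CharP.Lemmas
import Mathlib.Algebra.CharP.Algebra
import HarnessLib

/-!
# Stub `stub_formalOfLooseClean` for crux stmt-ResolutionOfSingularities-15917
(`RadicialJung.CleanModels`)

Safety certificate of the rev-6 cut of the crux (log-clean regular models): for a regular local
ring `O` of prime characteristic `p`, an `O`-algebra `K` and the `𝔪`-adic completion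
`ι : O → Ô = AdicCompletion (maximalIdeal O) O` with `𝔪̂ = 𝔪.map ι`,

* a Zariski-loosely clean `x ∈ K` (toroidal `u ∏ t_i^{a_i}` with `u ∈ O^×` and `(t_i)` a minimal
  generating system of `𝔪`; or a unit `u` with `u - c^p ∉ 𝔪` for all `c ∈ O`; or `s` with
  `s - c^p ∈ 𝔪 ∖ 𝔪²` for some `c ∈ O`) is formally clean with ALGEBRAIC boundary
  (`ι s = û ∏ ι(t_i)^{a_i}` with `û ∈ Ô^×`; or `ι u - ĉ^p ∉ 𝔪̂` for all `ĉ ∈ Ô`; or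
  `ι s - ĉ^p ∈ 𝔪̂ ∖ 𝔪̂²` for some `ĉ ∈ Ô`);
* the algebraized formal form implies the plain formal form (formal parameters `τ_i = ι(t_i)`,
  which generate `𝔪̂ = 𝔪 Ô`).

Ingredients (all Mathlib): `𝔪̂ = maximalIdeal Ô` (`AdicCompletion.maximalIdeal_eq_map`), the
residue fields of `O` and `Ô` agree (`AdicCompletion.residueField_map_bijective`), `O → Ô` is
faithfully flat (`AdicCompletion.flat_of_isNoetherian`,
`Module.FaithfullyFlat.of_flat_of_isLocalHom`) so `(I Ô) ∩ O = I`
(`Ideal.comap_map_eq_self_of_faithfullyFlat`), and the freshman's dream `(a - b)^p = a^p - b^p` in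
characteristic `p` (`sub_pow_char`).
-/

noncomputable section

set_option linter.dupNamespace false

open IsLocalRing

namespace Summit.ResolutionOfSingularities.ResolutionOfSingularities.Theorems.RadicialJung.CleanModels

universe u

section Completion

variable {O : Type u} [CommRing O] [IsLocalRing O] [IsNoetherianRing O]

/-- **Extended ideals contract back** along the completion map of a Noetherian local ring:
`ι y ∈ I Ô ↔ y ∈ I` for every ideal `I` of `O` (`O → Ô` is faithfully flat). -/
theorem algebraMap_mem_map_adicCompletion_iff (I : Ideal O) (y : O) :
    algebraMap O (AdicCompletion (maximalIdeal O) O) y ∈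
        I.map (algebraMap O (AdicCompletion (maximalIdeal O) O)) ↔ y ∈ I := by
  haveI : Module.FaithfullyFlat O (AdicCompletion (maximalIdeal O) O) :=
    Module.FaithfullyFlat.of_flat_of_isLocalHom
  rw [← Ideal.mem_comap, Ideal.comap_map_eq_self_of_faithfullyFlat]

/-- **Residual approximation**: every element `ĉ` of the completion `Ô` of a Noetherian local
ring `O` is congruent modulo `maximalIdeal Ô` to the image of some `c ∈ O` (the residue fields
of `O` and `Ô` agree). -/
theorem exists_algebraMap_sub_mem_maximalIdeal_adicCompletion
    (ĉ : AdicCompletion (maximalIdeal O) O) :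
    ∃ c : O, algebraMap O (AdicCompletion (maximalIdeal O) O) c - ĉ ∈
      maximalIdeal (AdicCompletion (maximalIdeal O) O) := by
  obtain ⟨z, hz⟩ := (AdicCompletion.residueField_map_bijective O).2 (residue _ ĉ)
  obtain ⟨c, rfl⟩ := residue_surjective z
  refine ⟨c, ?_⟩
  rw [← residue_eq_zero_iff, map_sub, sub_eq_zero, ← hz, ResidueField.map_residue]

/-- **Formal regular type (i) from algebraic regular type (i).** In a Noetherian local ring `O`
of prime characteristic `p`: if `u - c^p ∉ 𝔪` for every `c ∈ O`, then `ι u - ĉ^p ∉ 𝔪̂ = 𝔪 Ô`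
for every `ĉ ∈ Ô` (approximate `ĉ ≡ ι c (mod 𝔪̂)`, so `ĉ^p ≡ ι(c^p) (mod 𝔪̂)` by the
freshman's dream, and `𝔪̂ ∩ O = 𝔪`). -/
theorem algebraMap_sub_pow_notMem_map_maximalIdeal (p : ℕ) (hp : p.Prime) [CharP O p] (u : O)
    (hu : ∀ c : O, u - c ^ p ∉ maximalIdeal O) (ĉ : AdicCompletion (maximalIdeal O) O) :
    algebraMap O (AdicCompletion (maximalIdeal O) O) u - ĉ ^ p ∉
      (maximalIdeal O).map (algebraMap O (AdicCompletion (maximalIdeal O) O)) := by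
  haveI := Fact.mk hp
  haveI : CharP (AdicCompletion (maximalIdeal O) O) p :=
    charP_of_injective_algebraMap (AdicCompletion.of_injective (maximalIdeal O) O) p
  intro h
  obtain ⟨c, hc⟩ := exists_algebraMap_sub_mem_maximalIdeal_adicCompletion ĉ
  apply hu c
  rw [← algebraMap_mem_map_adicCompletion_iff (maximalIdeal O),
    map_sub (algebraMap O (AdicCompletion (maximalIdeal O) O)),
    map_pow (algebraMap O (AdicCompletion (maximalIdeal O) O)),
    ← AdicCompletion.maximalIdeal_eq_map]
  rw [← AdicCompletion.maximalIdeal_eq_map] at h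
  have key : algebraMap O (AdicCompletion (maximalIdeal O) O) u -
      algebraMap O (AdicCompletion (maximalIdeal O) O) c ^ p =
      (algebraMap O (AdicCompletion (maximalIdeal O) O) u - ĉ ^ p) -
        (algebraMap O (AdicCompletion (maximalIdeal O) O) c - ĉ) ^ p := by
    rw [sub_pow_char]; ring
  rw [key]
  exact Ideal.sub_mem _ h (Ideal.pow_mem_of_mem _ hc p hp.pos)

end Completion

/-- **Zariski loose cleanness is formally clean, with algebraic boundary** (safety of the rev-6
cut). In a regular local ring `O` of prime characteristic `p` with an `O`-algebra `K` and
completion `ι : O → Ô`: a loosely clean `x ∈ K` (`u ∏ t_i^{a_i}`, or a unit residually not a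
`p`-th power, or `c^p +` a regular parameter) is formally clean with algebraic boundary (first
conjunct: `û = ι u`; type (i): a `p`-th root `ĉ` of `ι u (mod 𝔪̂)` has residue `c̄` for some
`c ∈ O` and then `u - c^p ∈ 𝔪`; type (ii): `ĉ = ι c`, `𝔪̂² ∩ O = 𝔪²`), and the algebraized
formal form implies the plain formal form (second conjunct: `τ = ι ∘ t` generates
`𝔪̂ = 𝔪 Ô`). -/
theorem stub_formalOfLooseClean {O K : Type u} [CommRing O] [IsRegularLocalRing O] [CommRing K]
    [Algebra O K] (p : ℕ) (hp : p.Prime) [CharP O p] (x : K) :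
    (((∃ (d m : ℕ) (hmd : m ≤ d) (t : Fin d → O) (a : Fin m → ℕ) (u : O), IsUnit u ∧
          Ideal.span (Set.range t) = maximalIdeal O ∧
          ringKrullDim O = (d : WithBot ℕ∞) ∧ 0 < m ∧ (∀ i, ¬ p ∣ a i) ∧
          x = algebraMap O K (u * ∏ i : Fin m, t (Fin.castLE hmd i) ^ (a i))) ∨
        (∃ u : O, IsUnit u ∧ x = algebraMap O K u ∧ ∀ c : O, u - c ^ p ∉ maximalIdeal O) ∨
        (∃ s c : O, x = algebraMap O K s ∧ s - c ^ p ∈ maximalIdeal O ∧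
          s - c ^ p ∉ maximalIdeal O ^ 2)) →
      ((∃ (d m : ℕ) (hmd : m ≤ d) (t : Fin d → O) (a : Fin m → ℕ)
          (û : AdicCompletion (maximalIdeal O) O) (s : O), IsUnit û ∧
          Ideal.span (Set.range t) = maximalIdeal O ∧
          ringKrullDim O = (d : WithBot ℕ∞) ∧ 0 < m ∧ (∀ i, ¬ p ∣ a i) ∧
          x = algebraMap O K s ∧
          algebraMap O (AdicCompletion (maximalIdeal O) O) s =
            û * ∏ i : Fin m, algebraMap O (AdicCompletion (maximalIdeal O) O)
              (t (Fin.castLE hmd i)) ^ (a i)) ∨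
        (∃ u : O, IsUnit u ∧ x = algebraMap O K u ∧
          ∀ ĉ : AdicCompletion (maximalIdeal O) O,
            algebraMap O (AdicCompletion (maximalIdeal O) O) u - ĉ ^ p ∉
              (maximalIdeal O).map (algebraMap O (AdicCompletion (maximalIdeal O) O))) ∨
        (∃ (s : O) (ĉ : AdicCompletion (maximalIdeal O) O), x = algebraMap O K s ∧
          algebraMap O (AdicCompletion (maximalIdeal O) O) s - ĉ ^ p ∈
            (maximalIdeal O).map (algebraMap O (AdicCompletion (maximalIdeal O) O)) ∧
          algebraMap O (AdicCompletion (maximalIdeal O) O) s - ĉ ^ p ∉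
            (maximalIdeal O).map (algebraMap O (AdicCompletion (maximalIdeal O) O)) ^ 2))) ∧
    (((∃ (d m : ℕ) (hmd : m ≤ d) (t : Fin d → O) (a : Fin m → ℕ)
          (û : AdicCompletion (maximalIdeal O) O) (s : O), IsUnit û ∧
          Ideal.span (Set.range t) = maximalIdeal O ∧
          ringKrullDim O = (d : WithBot ℕ∞) ∧ 0 < m ∧ (∀ i, ¬ p ∣ a i) ∧
          x = algebraMap O K s ∧
          algebraMap O (AdicCompletion (maximalIdeal O) O) s =
            û * ∏ i : Fin m, algebraMap O (AdicCompletion (maximalIdeal O) O)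
              (t (Fin.castLE hmd i)) ^ (a i)) ∨
        (∃ u : O, IsUnit u ∧ x = algebraMap O K u ∧
          ∀ ĉ : AdicCompletion (maximalIdeal O) O,
            algebraMap O (AdicCompletion (maximalIdeal O) O) u - ĉ ^ p ∉
              (maximalIdeal O).map (algebraMap O (AdicCompletion (maximalIdeal O) O))) ∨
        (∃ (s : O) (ĉ : AdicCompletion (maximalIdeal O) O), x = algebraMap O K s ∧
          algebraMap O (AdicCompletion (maximalIdeal O) O) s - ĉ ^ p ∈
            (maximalIdeal O).map (algebraMap O (AdicCompletion (maximalIdeal O) O)) ∧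
          algebraMap O (AdicCompletion (maximalIdeal O) O) s - ĉ ^ p ∉
            (maximalIdeal O).map (algebraMap O (AdicCompletion (maximalIdeal O) O)) ^ 2)) →
      ((∃ (d m : ℕ) (hmd : m ≤ d) (τ : Fin d → AdicCompletion (maximalIdeal O) O) (a : Fin m → ℕ)
          (û : AdicCompletion (maximalIdeal O) O) (s : O), IsUnit û ∧
          Ideal.span (Set.range τ) =
            (maximalIdeal O).map (algebraMap O (AdicCompletion (maximalIdeal O) O)) ∧
          ringKrullDim O = (d : WithBot ℕ∞) ∧ 0 < m ∧ (∀ i, ¬ p ∣ a i) ∧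
          x = algebraMap O K s ∧
          algebraMap O (AdicCompletion (maximalIdeal O) O) s =
            û * ∏ i : Fin m, τ (Fin.castLE hmd i) ^ (a i)) ∨
        (∃ u : O, IsUnit u ∧ x = algebraMap O K u ∧
          ∀ ĉ : AdicCompletion (maximalIdeal O) O,
            algebraMap O (AdicCompletion (maximalIdeal O) O) u - ĉ ^ p ∉
              (maximalIdeal O).map (algebraMap O (AdicCompletion (maximalIdeal O) O))) ∨
        (∃ (s : O) (ĉ : AdicCompletion (maximalIdeal O) O), x = algebraMap O K s ∧
          algebraMap O (AdicCompletion (maximalIdeal O) O) s - ĉ ^ p ∈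
            (maximalIdeal O).map (algebraMap O (AdicCompletion (maximalIdeal O) O)) ∧
          algebraMap O (AdicCompletion (maximalIdeal O) O) s - ĉ ^ p ∉
            (maximalIdeal O).map (algebraMap O (AdicCompletion (maximalIdeal O) O)) ^ 2))) := by
  refine ⟨?_, ?_⟩
  · rintro (⟨d, m, hmd, t, a, u, hu, ht, hd, hm, ha, hx⟩ | ⟨u, hu, hx, hc⟩ | ⟨s, c, hx, h1, h2⟩)
    · refine Or.inl ⟨d, m, hmd, t, a, algebraMap O _ u, _, hu.map _, ht, hd, hm, ha, hx, ?_⟩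
      simp only [map_mul, map_prod, map_pow]
    · exact Or.inr (Or.inl ⟨u, hu, hx, algebraMap_sub_pow_notMem_map_maximalIdeal p hp u hc⟩)
    · refine Or.inr (Or.inr ⟨s, algebraMap O _ c, hx, ?_, ?_⟩)
      · rw [← map_pow (algebraMap O (AdicCompletion (maximalIdeal O) O)),
          ← map_sub (algebraMap O (AdicCompletion (maximalIdeal O) O))]
        exact Ideal.mem_map_of_mem _ h1
      · rw [← map_pow (algebraMap O (AdicCompletion (maximalIdeal O) O)),
          ← map_sub (algebraMap O (AdicCompletion (maximalIdeal O) O)), ← Ideal.map_pow,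
          algebraMap_mem_map_adicCompletion_iff]
        exact h2
  · rintro (⟨d, m, hmd, t, a, û, s, hû, ht, hd, hm, ha, hx, hs⟩ | h | h)
    · refine Or.inl ⟨d, m, hmd, fun i => algebraMap O _ (t i), a, û, s, hû, ?_, hd, hm, ha, hx, hs⟩
      rw [← ht, Ideal.map_span, ← Set.range_comp]
      rfl
    · exact Or.inr (Or.inl h)
    · exact Or.inr (Or.inr h)

end Summit.ResolutionOfSingularities.ResolutionOfSingularities.Theorems.RadicialJung.CleanModels

end
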